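import Literature.Probability.FitznerVanDerHofstad2017.Stage1PolygonDplus
import Literature.Probability.FitznerVanDerHofstad2017.Stage1StateD10Rev3
import HarnessLib

/-!
# HOME DRAFT (pub-lace10 typer g5, 2026-08-23; NOT filed — Level C is not staffed, lead RULING D29 (3); eng g14 NOTE 1 of bus l.343, «typer / Level-C lead to rule»)
# The k-SHIFTED additive open-triangle / open-square extraction cells: `Bound[OpenTriangle|OpenSquare,m,s]/(2dz)^k` with the explicit
# `Max[Σ_j … z^j nrBAW …]` summand divided by `(2dz)^k` like every other summand (`zsh P j k` in place of `z ^ j`)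

HONEST FRAMING.  Pure `PX` text (the syntax of `Stage1Cells`) + real-semantics identities that hold under ANY valuation + kernel evaluations of typed
cells over the landed `d = 10` record tables at a scratch point; ADDITIVE (no landed declaration is touched or shadowed); no numeral enters a Lean
statement except the kernel-decided brackets of §3; no percolation claim, no dimension-`10` sentence, nothing filed.

WHAT (eng g14 NOTE 1, `engine/ivq/levelC/c16/C16-COMPANION.md` 13145a90a3ddc423 §NOTE 1, confirmed by the typer's read).  The notebook letter is
`Bound[OpenTriangle,m,s]` (cell 12 = [NB] cell [49] l.107–116) — NO `k`; every USE site that needs the open polygon "per unit step" divides the WHOLE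
letter: `Bound[C3,1,1|0,1|1,0,s] = … Bound[OpenTriangle,3,s]/(2d z[s]) …` ([NB] l.309–311), `Bound[B2i,0|1,2,s]` (l.254–255).  The tree's cells carry
the divisor as the second index `k` ("`Bound[OpenTriangle,m,s]/(2dz)^k`", `Stage1Cells.openTriangle` docstring :240): in the AS-CODED product form
(`Stage1OpenBranchD11.openTriangleE` :85, [NB]'s `]]*` token, DIVERGENCE D12) the explicit `Max[Σ z^j …]` MULTIPLIES `… w P ^ (P.CS + 1 - k) …`, so the
whole product is divided once — consistent.  In the ADDITIVE readings (`Stage1OpenBranchD11.openTriangleEplus` :97 / `openSquareEplus` :120, D12's `*`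
read as `+`; `Stage1PolygonDplus.openTriangleEDplus` :153 / `openSquareEDplus` :168 and the slotted `Rem.` copies :227–264, D27-raised) the
`Max[Σ z^j …]` summand stands ALONE and keeps `z ^ j` — it is NOT divided by `(2dz)^k`, while the remainder summands are (`w P ^ (P.CS + 1 - k)`).
The open BUBBLE (`openBubbleE` :71, `openBubbleEDplus` :139), whose notebook cell IS additive, shifts correctly (`zsh P j k`).  Consequence (real
semantics, this file §2): `landed(m,k)·(2dz)^k = additive(m,0) + S_max(m)·((2dz)^k − 1)` whereas the engines' letter is `additive(m,0)`; the cells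
below put `zsh P j k` in the two `sumR`s and satisfy `shifted(m,k)·(2dz)^k = additive(m,0)` (`k ≤ m`, `k ≤ CS+1`); `shifted ≤ landed` whenever
`2dz ≥ 1` (both points: `2d z_i = 2d/(2d−1)`, `2d z_o = 2d Γ₁/(2d−1)`), so every landed `≤`-statement through the landed cells stays TRUE (conservative
direction; eng: «no landed theorem affected»), but a recipe that binds the landed `(3,1)` cell sits ABOVE the record there.
LIVE INSTANCE.  Of the open-polygon instances the Stage-1 recipe reads (`openTriangle (2,0),(3,0),(3,1),(4,0)`, `openSquare (3,0)`;
`Stage1PolygonDplus` §2 list) only `openTriangle (3,1)` has `k ≥ 1` (consumers: `C3 (0,1),(1,0),(1,1)` `Stage1CellsRem` :216–219, `B2i (0,2),(1,2)`);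
eng g14 at (P40, ρ40, `CertD10.stateRev3`): landed `Rem.openTriangleDplus 3 1` = record letter × (1 + 4.88 % (o) / + 4.18 % (i)), `(3,0)` ties ≤ 4e-76;
§3 below re-decides this on the tree side.  For `k = 0` the shifted and landed cells AGREE in value (§2 `…_zero`), so the square instances and the
A8 DEFAULT cell `Rem.openSquareEDunder` (typer g3 `typed/Stage1OpenSquareUnder_DRAFT.lean` 5f00418bd6f6061c, same `z ^ j` shape) are value-unaffected;
the same one-token substitution applies to their text if the Level-C lead wants the shifted shape uniformly.
OPTIONS for the Level-C lead (not decided here): (S) bind the shifted cells below in the P1.3 composite (ties the record letter; one more HOME text to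
file); (L) keep the landed cells (valid, +4.9 % looser at one letter; the P2.3 acceptance values then differ from eng2's at `C3`/`B2i` col-2 entries by
the booked amount).  An in-place edit of `Stage1PolygonDplus` / `Stage1OpenBranchD11` is NOT proposed: their §2–§4 kernel rows and the generated
`Stage1EvalDplus*` / `Stage1BetaD10Dplus` / `Stage1TailsDplusD10` brackets are decided for the landed text.

Sources: R. Fitzner, R. van der Hofstad, *Generalized approach to the non-backtracking lace expansion*, PTRF 169 (2017) [NoBLE17-I] §5.3.2
(5.40)–(5.42) p. 1098 (repulsive open-polygon extraction bounds); *Mean-field behavior for nearest-neighbor percolation in d > 10*, EJP 22 (2017)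
no. 43 [FvdH17], notebook `Percolation.nb` cell 12 ([NB] = `pub-lace7/engine/eng2/nbtext/Percolation.m` cell [49] l.107–116; use sites cell [90]-class
l.254–256, l.306–314); tree `Stage1Cells.lean` :144 (`zsh`), :233–260 (as-coded cells), `Stage1OpenBranchD11.lean` :60–131, `Stage1PolygonDplus.lean`
:109–290; eng g14 `C16-COMPANION.md` NOTE 1 + `GmaxProbe.lean` 8d1eda27ccd96d62 (`GOT|` rows).
[cite: FitznerVanDerHofstad2016NoBLE, §5.3.2 (5.40)–(5.42) PTRF p. 1098] [cite: FitznerVanDerHofstad2017, notebook Percolation.nb cell 12 (transcript l.419–429)]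
-/

set_option Elab.async false

namespace Literature.Probability.FitznerVanDerHofstad2017
namespace Stage1Cells

open NoGoFrame PX

/-! ## §1 The shifted cells (generic in `P`; plain table reads) -/

section plain

variable (P : Params)

/-- the explicit extraction summand of the open triangle ALONE, unshifted: `Max[Σ_{j=m}^{CS} ½(j+1−m)(j+2−m) z^j nrBAW[j,d,{2}], same with {1}]`
(the first summand of every landed additive open-triangle cell, any `k`). [cite: FitznerVanDerHofstad2017, notebook Percolation.nb cell 12 (transcript l.419–429)] -/
def openTriangleSmax (m : ℕ) : T :=
  max (sumR m P.CS fun j => C (j + 1 - m) * C (j + 2 - m) * z ^ j * tab (.baw j .v2) /ₙ 2)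
      (sumR m P.CS fun j => C (j + 1 - m) * C (j + 2 - m) * z ^ j * tab (.baw j .v1) /ₙ 2)

/-- the explicit extraction summand of the open square ALONE, unshifted. [cite: FitznerVanDerHofstad2017, notebook Percolation.nb cell 12 (transcript l.419–429)] -/
def openSquareSmax (m : ℕ) : T :=
  max (sumR m P.CS fun j => C (j + 1 - m) * C (j + 2 - m) * C (j + 3 - m) * z ^ j * tab (.baw j .v2) /ₙ 6)
      (sumR m P.CS fun j => C (j + 1 - m) * C (j + 2 - m) * C (j + 3 - m) * z ^ j * tab (.baw j .v1) /ₙ 6)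

/-- k-SHIFTED D12-additive open-triangle extraction branch (`Stage1OpenBranchD11.openTriangleEplus` with `zsh P j k` for `z ^ j`; coded multiplicities):
`Bound[OpenTriangle,m,s]/(2dz)^k`, additive reading. [cite: FitznerVanDerHofstad2016NoBLE, §5.3.2 (5.41) PTRF p. 1098] -/
def openTriangleEsh (m k : ℕ) : T :=
  max (sumR m P.CS fun j => C (j + 1 - m) * C (j + 2 - m) * zsh P j k * tab (.baw j .v2) /ₙ 2)
      (sumR m P.CS fun j => C (j + 1 - m) * C (j + 2 - m) * zsh P j k * tab (.baw j .v1) /ₙ 2)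
    + C (P.CS + 1 - m) * C (P.CS - m) * w P ^ (P.CS + 1 - k) * Vg * tab (.K 1 (P.CS + 1) .v1) /ₙ 2
    + C (P.CS + 1 - m) * w P ^ (P.CS + 1 - k) * Vg ^ 2 * tab (.K 2 (P.CS + 1) .v1)
    + w P ^ (P.CS + 1 - k) * Vg ^ 3 * tab (.K 3 (P.CS + 1) .v1)

/-- k-SHIFTED D27-raised additive open-triangle extraction branch (`Stage1PolygonDplus.openTriangleEDplus` with `zsh P j k` for `z ^ j`; one-tail `C(L+2,2)`).
[cite: FitznerVanDerHofstad2016NoBLE, §5.3.2 (5.41) PTRF p. 1098] -/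
def openTriangleEDsh (m k : ℕ) : T :=
  max (sumR m P.CS fun j => C (j + 1 - m) * C (j + 2 - m) * zsh P j k * tab (.baw j .v2) /ₙ 2)
      (sumR m P.CS fun j => C (j + 1 - m) * C (j + 2 - m) * zsh P j k * tab (.baw j .v1) /ₙ 2)
    + C (P.CS + 2 - m) * C (P.CS + 1 - m) * w P ^ (P.CS + 1 - k) * Vg * tab (.K 1 (P.CS + 1) .v1) /ₙ 2
    + C (P.CS + 1 - m) * w P ^ (P.CS + 1 - k) * Vg ^ 2 * tab (.K 2 (P.CS + 1) .v1)
    + w P ^ (P.CS + 1 - k) * Vg ^ 3 * tab (.K 3 (P.CS + 1) .v1)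

/-- k-SHIFTED D12-additive open-square extraction branch (`Stage1OpenBranchD11.openSquareEplus` with `zsh P j k`; coded multiplicities, literal `10`s).
[cite: FitznerVanDerHofstad2016NoBLE, §5.3.2 (5.42) PTRF p. 1098] -/
def openSquareEsh (m k : ℕ) : T :=
  max (sumR m P.CS fun j => C (j + 1 - m) * C (j + 2 - m) * C (j + 3 - m) * zsh P j k * tab (.baw j .v2) /ₙ 6)
      (sumR m P.CS fun j => C (j + 1 - m) * C (j + 2 - m) * C (j + 3 - m) * zsh P j k * tab (.baw j .v1) /ₙ 6)
    + C (10 + 1 - m) * C (10 + 2 - m) * C (10 + 3 - m) * w P ^ (P.CS + 1 - k) * Vg * tab (.K 1 (P.CS + 1) .v1) /ₙ 6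
    + C (10 - m) * C (10 - 1 - m) * w P ^ (P.CS + 1 - k) * Vg ^ 2 * tab (.K 2 (P.CS + 1) .v1) /ₙ 2
    + C (10 - m) * w P ^ (P.CS + 1 - k) * Vg ^ 3 * tab (.K 3 (P.CS + 1) .v1)
    + w P ^ (P.CS + 1 - k) * Vg ^ 4 * tab (.K 4 (P.CS + 1) .v1)

/-- k-SHIFTED D27+D26 additive open-square extraction branch (`Stage1PolygonDplus.openSquareEDplus` with `zsh P j k`).
[cite: FitznerVanDerHofstad2016NoBLE, §5.3.2 (5.42) PTRF p. 1098] -/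
def openSquareEDsh (m k : ℕ) : T :=
  max (sumR m P.CS fun j => C (j + 1 - m) * C (j + 2 - m) * C (j + 3 - m) * zsh P j k * tab (.baw j .v2) /ₙ 6)
      (sumR m P.CS fun j => C (j + 1 - m) * C (j + 2 - m) * C (j + 3 - m) * zsh P j k * tab (.baw j .v1) /ₙ 6)
    + C (P.CS + 1 - m) * C (P.CS + 2 - m) * C (P.CS + 3 - m) * w P ^ (P.CS + 1 - k) * Vg * tab (.K 1 (P.CS + 1) .v1) /ₙ 6
    + C (P.CS + 2 - m) * C (P.CS + 1 - m) * w P ^ (P.CS + 1 - k) * Vg ^ 2 * tab (.K 2 (P.CS + 1) .v1) /ₙ 2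
    + C (P.CS + 1 - m) * w P ^ (P.CS + 1 - k) * Vg ^ 3 * tab (.K 3 (P.CS + 1) .v1)
    + w P ^ (P.CS + 1 - k) * Vg ^ 4 * tab (.K 4 (P.CS + 1) .v1)

/-- shifted D27 open triangle `Min[K-branch, EDsh]`. [cite: FitznerVanDerHofstad2016NoBLE, §5.3.2 (5.41) PTRF p. 1098] -/
def openTriangleDsh (m k : ℕ) : T := min (openTriangleK P m k) (openTriangleEDsh P m k)

/-- shifted D27+D26 open square `Min[K-branch, EDsh]`. [cite: FitznerVanDerHofstad2016NoBLE, §5.3.2 (5.42) PTRF p. 1098] -/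
def openSquareDsh (m k : ℕ) : T := min (openSquareK P m k) (openSquareEDsh P m k)

end plain

/-! ## §1′ The same over the SLOTTED recipe `Stage1Cells.Rem` (remainder reads `K[n,CS+1,{1}] ↦ ρ (n+5)`) -/

namespace Rem

section slotted

variable (P : Params) (ρ : Fin 10 → T)

/-- (slotted) k-SHIFTED D12-additive open-triangle extraction branch (`Rem.openTriangleEplus` of `Stage1PolygonDplus` :227 with `zsh P j k`).
[cite: FitznerVanDerHofstad2016NoBLE, §5.3.2 (5.41) PTRF p. 1098] -/
def openTriangleEsh (m k : ℕ) : T :=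
  max (sumR m P.CS fun j => C (j + 1 - m) * C (j + 2 - m) * zsh P j k * tab (.baw j .v2) /ₙ 2)
      (sumR m P.CS fun j => C (j + 1 - m) * C (j + 2 - m) * zsh P j k * tab (.baw j .v1) /ₙ 2)
    + C (P.CS + 1 - m) * C (P.CS - m) * w P ^ (P.CS + 1 - k) * Vg * ρ 6 /ₙ 2
    + C (P.CS + 1 - m) * w P ^ (P.CS + 1 - k) * Vg ^ 2 * ρ 7
    + w P ^ (P.CS + 1 - k) * Vg ^ 3 * ρ 8

/-- (slotted) k-SHIFTED D27-raised additive open-triangle extraction branch (`Rem.openTriangleEDplus` :246 with `zsh P j k`).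
[cite: FitznerVanDerHofstad2016NoBLE, §5.3.2 (5.41) PTRF p. 1098] -/
def openTriangleEDsh (m k : ℕ) : T :=
  max (sumR m P.CS fun j => C (j + 1 - m) * C (j + 2 - m) * zsh P j k * tab (.baw j .v2) /ₙ 2)
      (sumR m P.CS fun j => C (j + 1 - m) * C (j + 2 - m) * zsh P j k * tab (.baw j .v1) /ₙ 2)
    + C (P.CS + 2 - m) * C (P.CS + 1 - m) * w P ^ (P.CS + 1 - k) * Vg * ρ 6 /ₙ 2
    + C (P.CS + 1 - m) * w P ^ (P.CS + 1 - k) * Vg ^ 2 * ρ 7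
    + w P ^ (P.CS + 1 - k) * Vg ^ 3 * ρ 8

/-- (slotted) k-SHIFTED D12-additive open-square extraction branch (`Rem.openSquareEplus` :236 with `zsh P j k`).
[cite: FitznerVanDerHofstad2016NoBLE, §5.3.2 (5.42) PTRF p. 1098] -/
def openSquareEsh (m k : ℕ) : T :=
  max (sumR m P.CS fun j => C (j + 1 - m) * C (j + 2 - m) * C (j + 3 - m) * zsh P j k * tab (.baw j .v2) /ₙ 6)
      (sumR m P.CS fun j => C (j + 1 - m) * C (j + 2 - m) * C (j + 3 - m) * zsh P j k * tab (.baw j .v1) /ₙ 6)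
    + C (10 + 1 - m) * C (10 + 2 - m) * C (10 + 3 - m) * w P ^ (P.CS + 1 - k) * Vg * ρ 6 /ₙ 6
    + C (10 - m) * C (10 - 1 - m) * w P ^ (P.CS + 1 - k) * Vg ^ 2 * ρ 7 /ₙ 2
    + C (10 - m) * w P ^ (P.CS + 1 - k) * Vg ^ 3 * ρ 8
    + w P ^ (P.CS + 1 - k) * Vg ^ 4 * ρ 9

/-- (slotted) k-SHIFTED D27+D26 additive open-square extraction branch (`Rem.openSquareEDplus` :258 with `zsh P j k`).
[cite: FitznerVanDerHofstad2016NoBLE, §5.3.2 (5.42) PTRF p. 1098] -/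
def openSquareEDsh (m k : ℕ) : T :=
  max (sumR m P.CS fun j => C (j + 1 - m) * C (j + 2 - m) * C (j + 3 - m) * zsh P j k * tab (.baw j .v2) /ₙ 6)
      (sumR m P.CS fun j => C (j + 1 - m) * C (j + 2 - m) * C (j + 3 - m) * zsh P j k * tab (.baw j .v1) /ₙ 6)
    + C (P.CS + 1 - m) * C (P.CS + 2 - m) * C (P.CS + 3 - m) * w P ^ (P.CS + 1 - k) * Vg * ρ 6 /ₙ 6
    + C (P.CS + 2 - m) * C (P.CS + 1 - m) * w P ^ (P.CS + 1 - k) * Vg ^ 2 * ρ 7 /ₙ 2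
    + C (P.CS + 1 - m) * w P ^ (P.CS + 1 - k) * Vg ^ 3 * ρ 8
    + w P ^ (P.CS + 1 - k) * Vg ^ 4 * ρ 9

/-- (slotted) shifted D27 open triangle `Min[K-branch, EDsh]`. [cite: FitznerVanDerHofstad2016NoBLE, §5.3.2 (5.41) PTRF p. 1098] -/
def openTriangleDsh (m k : ℕ) : T := min (openTriangleK P m k) (Rem.openTriangleEDsh P ρ m k)

/-- (slotted) shifted D27+D26 open square `Min[K-branch, EDsh]`. [cite: FitznerVanDerHofstad2016NoBLE, §5.3.2 (5.42) PTRF p. 1098] -/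
def openSquareDsh (m k : ℕ) : T := min (openSquareK P m k) (Rem.openSquareEDsh P ρ m k)

end slotted

section Repro

variable (P : Params)

/-- literal reproduction: the slotted cell at the record reads IS the plain cell. [cite: FitznerVanDerHofstad2017, notebook Percolation.nb cell 12 (transcript l.419–429)] -/
@[simp] theorem openTriangleEsh_print (m k : ℕ) : Rem.openTriangleEsh P (printSlots P) m k = Stage1Cells.openTriangleEsh P m k := rfl
/-- literal reproduction. [cite: FitznerVanDerHofstad2017, notebook Percolation.nb cell 12 (transcript l.419–429)] -/
@[simp] theorem openTriangleEDsh_print (m k : ℕ) : Rem.openTriangleEDsh P (printSlots P) m k = Stage1Cells.openTriangleEDsh P m k := rfl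
/-- literal reproduction. [cite: FitznerVanDerHofstad2017, notebook Percolation.nb cell 12 (transcript l.419–429)] -/
@[simp] theorem openSquareEsh_print (m k : ℕ) : Rem.openSquareEsh P (printSlots P) m k = Stage1Cells.openSquareEsh P m k := rfl
/-- literal reproduction. [cite: FitznerVanDerHofstad2017, notebook Percolation.nb cell 12 (transcript l.419–429)] -/
@[simp] theorem openSquareEDsh_print (m k : ℕ) : Rem.openSquareEDsh P (printSlots P) m k = Stage1Cells.openSquareEDsh P m k := rfl
/-- literal reproduction. [cite: FitznerVanDerHofstad2017, notebook Percolation.nb cell 12 (transcript l.419–429)] -/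
@[simp] theorem openTriangleDsh_print (m k : ℕ) : Rem.openTriangleDsh P (printSlots P) m k = Stage1Cells.openTriangleDsh P m k := rfl
/-- literal reproduction. [cite: FitznerVanDerHofstad2017, notebook Percolation.nb cell 12 (transcript l.419–429)] -/
@[simp] theorem openSquareDsh_print (m k : ℕ) : Rem.openSquareDsh P (printSlots P) m k = Stage1Cells.openSquareDsh P m k := rfl

end Repro

/-! ## §2 Real semantics under ANY valuation: `shifted·(2dz)^k = additive(m,0)`, `landed·(2dz)^k = additive(m,0) + S_max·((2dz)^k − 1)`, `shifted ≤ landed` -/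

section Semantics

variable (P : Params) (ρ : Fin 10 → T) {va : Atom → ℝ} {vt : TKey → ℝ}

/-- the shift identity on one summand: `⟦z^{j−k}/(2d)^k⟧ · (2d·z)^k = z^j` for `k ≤ j` (`d ≥ 1`) (private algebra helper of the
identities (A)/(B) below). [folklore] -/
private theorem eval_zsh_mul_wpow (hd : 0 < P.d) {j k : ℕ} (hkj : k ≤ j) :
    eval va vt (zsh P j k) * eval va vt (w P) ^ k = va .z ^ j := by
  obtain ⟨i, rfl⟩ := Nat.exists_eq_add_of_le hkj
  have hd' : (0 : ℝ) < (P.d : ℝ) := Nat.cast_pos.mpr hd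
  simp only [zsh, w, z, eval_divN, eval_hpow, eval_atom, eval_mul, eval_C, Nat.add_sub_cancel_left, Nat.cast_pow, Nat.cast_mul,
    Nat.cast_ofNat]
  rw [mul_pow, mul_pow, pow_add]
  field_simp
  ring

/-- `(2dz)^k ≥ 0` when `z ≥ 0` (private helper). [folklore] -/
private theorem eval_wpow_nonneg (hz : 0 ≤ va .z) (k : ℕ) : 0 ≤ eval va vt (w P) ^ k := by
  apply pow_nonneg; simp only [w, z, eval_mul, eval_C, eval_atom]; positivity

/-- shifted TRIANGLE summands re-assemble to the unshifted ones after multiplication by `(2dz)^k` (`k ≤ m`) (private helper). [folklore] -/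
private theorem sum_tri_shift (hd : 0 < P.d) {m k : ℕ} (hk : k ≤ m) (v : V) :
    (∑ j ∈ Finset.Icc m P.CS, eval va vt (C (j + 1 - m) * C (j + 2 - m) * zsh P j k * tab (.baw j v) /ₙ 2)) * eval va vt (w P) ^ k
      = ∑ j ∈ Finset.Icc m P.CS, eval va vt (C (j + 1 - m) * C (j + 2 - m) * z ^ j * tab (.baw j v) /ₙ 2) := by
  rw [Finset.sum_mul]
  refine Finset.sum_congr rfl fun j hj => ?_
  have e := eval_zsh_mul_wpow P (va := va) (vt := vt) hd (le_trans hk (Finset.mem_Icc.mp hj).1)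
  simp only [eval_divN, eval_mul, eval_C, eval_hpow, eval_tab]
  rw [show eval va vt z = va .z from rfl, ← e]
  ring

/-- shifted SQUARE summands re-assemble to the unshifted ones after multiplication by `(2dz)^k` (`k ≤ m`) (private helper). [folklore] -/
private theorem sum_sq_shift (hd : 0 < P.d) {m k : ℕ} (hk : k ≤ m) (v : V) :
    (∑ j ∈ Finset.Icc m P.CS, eval va vt (C (j + 1 - m) * C (j + 2 - m) * C (j + 3 - m) * zsh P j k * tab (.baw j v) /ₙ 6)) * eval va vt (w P) ^ k
      = ∑ j ∈ Finset.Icc m P.CS, eval va vt (C (j + 1 - m) * C (j + 2 - m) * C (j + 3 - m) * z ^ j * tab (.baw j v) /ₙ 6) := by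
  rw [Finset.sum_mul]
  refine Finset.sum_congr rfl fun j hj => ?_
  have e := eval_zsh_mul_wpow P (va := va) (vt := vt) hd (le_trans hk (Finset.mem_Icc.mp hj).1)
  simp only [eval_divN, eval_mul, eval_C, eval_hpow, eval_tab]
  rw [show eval va vt z = va .z from rfl, ← e]
  ring

/-! ### (A) the shifted cells carry the intended letter: `⟦shifted(m,k)⟧·(2dz)^k = ⟦additive(m,0)⟧` -/

/-- **THE INTENDED LETTER, D27 triangle.** `⟦Rem.openTriangleEDsh m k⟧ · (2dz)^k = ⟦Rem.openTriangleEDplus m 0⟧` (= the additive D27 `Bound[OpenTriangle,m,s]`)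
for `k ≤ m`, `k ≤ CS+1`, `z ≥ 0`, `d ≥ 1`, under any valuation. [cite: FitznerVanDerHofstad2017, notebook Percolation.nb cell 12 (transcript l.419–429)] -/
theorem eval_openTriangleEDsh_mul_wpow (hd : 0 < P.d) {m k : ℕ} (hk : k ≤ m) (hkC : k ≤ P.CS + 1) (hz : 0 ≤ va .z) :
    eval va vt (Rem.openTriangleEDsh P ρ m k) * eval va vt (w P) ^ k = eval va vt (Rem.openTriangleEDplus P ρ m 0) := by
  simp only [Rem.openTriangleEDsh, Rem.openTriangleEDplus, eval_add, eval_max, eval_sumR]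
  rw [add_mul, add_mul, add_mul, max_mul_of_nonneg _ _ (eval_wpow_nonneg P hz k), sum_tri_shift P hd hk .v2, sum_tri_shift P hd hk .v1]
  simp only [eval_mul, eval_divN, eval_C, eval_hpow, Nat.sub_zero]
  rw [← pow_sub_mul_pow (eval va vt (w P)) hkC]
  ring

/-- **the intended letter, D12 triangle** (coded multiplicities): `⟦Rem.openTriangleEsh m k⟧ · (2dz)^k = ⟦Rem.openTriangleEplus m 0⟧`.
[cite: FitznerVanDerHofstad2017, notebook Percolation.nb cell 12 (transcript l.419–429)] -/
theorem eval_openTriangleEsh_mul_wpow (hd : 0 < P.d) {m k : ℕ} (hk : k ≤ m) (hkC : k ≤ P.CS + 1) (hz : 0 ≤ va .z) :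
    eval va vt (Rem.openTriangleEsh P ρ m k) * eval va vt (w P) ^ k = eval va vt (Rem.openTriangleEplus P ρ m 0) := by
  simp only [Rem.openTriangleEsh, Rem.openTriangleEplus, eval_add, eval_max, eval_sumR]
  rw [add_mul, add_mul, add_mul, max_mul_of_nonneg _ _ (eval_wpow_nonneg P hz k), sum_tri_shift P hd hk .v2, sum_tri_shift P hd hk .v1]
  simp only [eval_mul, eval_divN, eval_C, eval_hpow, Nat.sub_zero]
  rw [← pow_sub_mul_pow (eval va vt (w P)) hkC]
  ring

/-- **the intended letter, D27+D26 square.** `⟦Rem.openSquareEDsh m k⟧ · (2dz)^k = ⟦Rem.openSquareEDplus m 0⟧`.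
[cite: FitznerVanDerHofstad2017, notebook Percolation.nb cell 12 (transcript l.419–429)] -/
theorem eval_openSquareEDsh_mul_wpow (hd : 0 < P.d) {m k : ℕ} (hk : k ≤ m) (hkC : k ≤ P.CS + 1) (hz : 0 ≤ va .z) :
    eval va vt (Rem.openSquareEDsh P ρ m k) * eval va vt (w P) ^ k = eval va vt (Rem.openSquareEDplus P ρ m 0) := by
  simp only [Rem.openSquareEDsh, Rem.openSquareEDplus, eval_add, eval_max, eval_sumR]
  rw [add_mul, add_mul, add_mul, add_mul, max_mul_of_nonneg _ _ (eval_wpow_nonneg P hz k), sum_sq_shift P hd hk .v2, sum_sq_shift P hd hk .v1]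
  simp only [eval_mul, eval_divN, eval_C, eval_hpow, Nat.sub_zero]
  rw [← pow_sub_mul_pow (eval va vt (w P)) hkC]
  ring

/-- **the intended letter, D12 square** (coded multiplicities, literal `10`s): `⟦Rem.openSquareEsh m k⟧ · (2dz)^k = ⟦Rem.openSquareEplus m 0⟧`.
[cite: FitznerVanDerHofstad2017, notebook Percolation.nb cell 12 (transcript l.419–429)] -/
theorem eval_openSquareEsh_mul_wpow (hd : 0 < P.d) {m k : ℕ} (hk : k ≤ m) (hkC : k ≤ P.CS + 1) (hz : 0 ≤ va .z) :
    eval va vt (Rem.openSquareEsh P ρ m k) * eval va vt (w P) ^ k = eval va vt (Rem.openSquareEplus P ρ m 0) := by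
  simp only [Rem.openSquareEsh, Rem.openSquareEplus, eval_add, eval_max, eval_sumR]
  rw [add_mul, add_mul, add_mul, add_mul, max_mul_of_nonneg _ _ (eval_wpow_nonneg P hz k), sum_sq_shift P hd hk .v2, sum_sq_shift P hd hk .v1]
  simp only [eval_mul, eval_divN, eval_C, eval_hpow, Nat.sub_zero]
  rw [← pow_sub_mul_pow (eval va vt (w P)) hkC]
  ring

/-! ### (B) what the LANDED additive cells carry instead: `⟦landed(m,k)⟧·(2dz)^k = ⟦additive(m,0)⟧ + ⟦S_max(m)⟧·((2dz)^k − 1)` -/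

/-- **THE LANDED LETTER, D27 triangle.** `⟦Rem.openTriangleEDplus m k⟧ · (2dz)^k = ⟦Rem.openTriangleEDplus m 0⟧ + ⟦openTriangleSmax m⟧ · ((2dz)^k − 1)`
for `k ≤ CS+1` (any valuation): the explicit max-sum is the one summand NOT divided by `(2dz)^k`. [cite: FitznerVanDerHofstad2017, notebook Percolation.nb cell 12 (transcript l.419–429)] -/
theorem eval_openTriangleEDplus_mul_wpow {m k : ℕ} (hkC : k ≤ P.CS + 1) :
    eval va vt (Rem.openTriangleEDplus P ρ m k) * eval va vt (w P) ^ k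
      = eval va vt (Rem.openTriangleEDplus P ρ m 0) + eval va vt (openTriangleSmax P m) * (eval va vt (w P) ^ k - 1) := by
  simp only [Rem.openTriangleEDplus, openTriangleSmax, eval_add, eval_max, eval_mul, eval_divN, eval_C, eval_hpow, Nat.sub_zero]
  rw [← pow_sub_mul_pow (eval va vt (w P)) hkC]
  ring

/-- the landed letter, D12 triangle: `⟦Rem.openTriangleEplus m k⟧ · (2dz)^k = ⟦Rem.openTriangleEplus m 0⟧ + ⟦openTriangleSmax m⟧ · ((2dz)^k − 1)`.
[cite: FitznerVanDerHofstad2017, notebook Percolation.nb cell 12 (transcript l.419–429)] -/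
theorem eval_openTriangleEplus_mul_wpow {m k : ℕ} (hkC : k ≤ P.CS + 1) :
    eval va vt (Rem.openTriangleEplus P ρ m k) * eval va vt (w P) ^ k
      = eval va vt (Rem.openTriangleEplus P ρ m 0) + eval va vt (openTriangleSmax P m) * (eval va vt (w P) ^ k - 1) := by
  simp only [Rem.openTriangleEplus, openTriangleSmax, eval_add, eval_max, eval_mul, eval_divN, eval_C, eval_hpow, Nat.sub_zero]
  rw [← pow_sub_mul_pow (eval va vt (w P)) hkC]
  ring

/-- the landed letter, D27+D26 square: `⟦Rem.openSquareEDplus m k⟧ · (2dz)^k = ⟦Rem.openSquareEDplus m 0⟧ + ⟦openSquareSmax m⟧ · ((2dz)^k − 1)`.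
[cite: FitznerVanDerHofstad2017, notebook Percolation.nb cell 12 (transcript l.419–429)] -/
theorem eval_openSquareEDplus_mul_wpow {m k : ℕ} (hkC : k ≤ P.CS + 1) :
    eval va vt (Rem.openSquareEDplus P ρ m k) * eval va vt (w P) ^ k
      = eval va vt (Rem.openSquareEDplus P ρ m 0) + eval va vt (openSquareSmax P m) * (eval va vt (w P) ^ k - 1) := by
  simp only [Rem.openSquareEDplus, openSquareSmax, eval_add, eval_max, eval_mul, eval_divN, eval_C, eval_hpow, Nat.sub_zero]
  rw [← pow_sub_mul_pow (eval va vt (w P)) hkC]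
  ring

/-- the landed letter, D12 square: `⟦Rem.openSquareEplus m k⟧ · (2dz)^k = ⟦Rem.openSquareEplus m 0⟧ + ⟦openSquareSmax m⟧ · ((2dz)^k − 1)`.
[cite: FitznerVanDerHofstad2017, notebook Percolation.nb cell 12 (transcript l.419–429)] -/
theorem eval_openSquareEplus_mul_wpow {m k : ℕ} (hkC : k ≤ P.CS + 1) :
    eval va vt (Rem.openSquareEplus P ρ m k) * eval va vt (w P) ^ k
      = eval va vt (Rem.openSquareEplus P ρ m 0) + eval va vt (openSquareSmax P m) * (eval va vt (w P) ^ k - 1) := by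
  simp only [Rem.openSquareEplus, openSquareSmax, eval_add, eval_max, eval_mul, eval_divN, eval_C, eval_hpow, Nat.sub_zero]
  rw [← pow_sub_mul_pow (eval va vt (w P)) hkC]
  ring

/-! ### (C) `k = 0`: shifted and landed AGREE; `2dz ≥ 1`: shifted ≤ landed (the landed cells are conservative) -/

/-- at `k = 0` the shifted D27 triangle IS the landed one in value. [cite: FitznerVanDerHofstad2017, notebook Percolation.nb cell 12 (transcript l.419–429)] -/
theorem eval_openTriangleEDsh_zero (hd : 0 < P.d) (hz : 0 ≤ va .z) (m : ℕ) :
    eval va vt (Rem.openTriangleEDsh P ρ m 0) = eval va vt (Rem.openTriangleEDplus P ρ m 0) := by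
  simpa only [pow_zero, mul_one] using eval_openTriangleEDsh_mul_wpow P ρ (va := va) (vt := vt) hd (Nat.zero_le m) (Nat.zero_le _) hz

/-- at `k = 0` the shifted D27+D26 square IS the landed one in value. [cite: FitznerVanDerHofstad2017, notebook Percolation.nb cell 12 (transcript l.419–429)] -/
theorem eval_openSquareEDsh_zero (hd : 0 < P.d) (hz : 0 ≤ va .z) (m : ℕ) :
    eval va vt (Rem.openSquareEDsh P ρ m 0) = eval va vt (Rem.openSquareEDplus P ρ m 0) := by
  simpa only [pow_zero, mul_one] using eval_openSquareEDsh_mul_wpow P ρ (va := va) (vt := vt) hd (Nat.zero_le m) (Nat.zero_le _) hz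

/-- at `k = 0` the shifted D12 triangle IS the landed one in value. [cite: FitznerVanDerHofstad2017, notebook Percolation.nb cell 12 (transcript l.419–429)] -/
theorem eval_openTriangleEsh_zero (hd : 0 < P.d) (hz : 0 ≤ va .z) (m : ℕ) :
    eval va vt (Rem.openTriangleEsh P ρ m 0) = eval va vt (Rem.openTriangleEplus P ρ m 0) := by
  simpa only [pow_zero, mul_one] using eval_openTriangleEsh_mul_wpow P ρ (va := va) (vt := vt) hd (Nat.zero_le m) (Nat.zero_le _) hz

/-- at `k = 0` the shifted D12 square IS the landed one in value. [cite: FitznerVanDerHofstad2017, notebook Percolation.nb cell 12 (transcript l.419–429)] -/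
theorem eval_openSquareEsh_zero (hd : 0 < P.d) (hz : 0 ≤ va .z) (m : ℕ) :
    eval va vt (Rem.openSquareEsh P ρ m 0) = eval va vt (Rem.openSquareEplus P ρ m 0) := by
  simpa only [pow_zero, mul_one] using eval_openSquareEsh_mul_wpow P ρ (va := va) (vt := vt) hd (Nat.zero_le m) (Nat.zero_le _) hz

/-- **DIRECTION, D27 triangle**: for a non-negative valuation with `2dz ≥ 1`, `⟦Rem.openTriangleEDsh m k⟧ ≤ ⟦Rem.openTriangleEDplus m k⟧` (`k ≤ m`, `k ≤ CS+1`,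
`d ≥ 1`) — the landed cell over-bounds the intended letter by `⟦S_max⟧·(1 − (2dz)^{−k})`. [cite: FitznerVanDerHofstad2017, notebook Percolation.nb cell 12 (transcript l.419–429)] -/
theorem eval_openTriangleEDsh_le_EDplus (hd : 0 < P.d) {m k : ℕ} (hk : k ≤ m) (hkC : k ≤ P.CS + 1)
    (ha : ∀ i, 0 ≤ va i) (ht : ∀ t, 0 ≤ vt t) (hw : 1 ≤ eval va vt (w P)) :
    eval va vt (Rem.openTriangleEDsh P ρ m k) ≤ eval va vt (Rem.openTriangleEDplus P ρ m k) := by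
  have hWk : 1 ≤ eval va vt (w P) ^ k := one_le_pow₀ hw
  have hS : 0 ≤ eval va vt (openTriangleSmax P m) := eval_nonneg ha ht _
  have hA := eval_openTriangleEDsh_mul_wpow P ρ (va := va) (vt := vt) hd hk hkC (ha .z)
  have hB := eval_openTriangleEDplus_mul_wpow P ρ (va := va) (vt := vt) (m := m) hkC
  have key : eval va vt (Rem.openTriangleEDsh P ρ m k) * eval va vt (w P) ^ k ≤ eval va vt (Rem.openTriangleEDplus P ρ m k) * eval va vt (w P) ^ k := by
    rw [hA, hB]; nlinarith
  exact le_of_mul_le_mul_right key (lt_of_lt_of_le one_pos hWk)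

/-- DIRECTION, D12 triangle: `⟦Rem.openTriangleEsh m k⟧ ≤ ⟦Rem.openTriangleEplus m k⟧` under the same hypotheses. [cite: FitznerVanDerHofstad2017, notebook Percolation.nb cell 12 (transcript l.419–429)] -/
theorem eval_openTriangleEsh_le_Eplus (hd : 0 < P.d) {m k : ℕ} (hk : k ≤ m) (hkC : k ≤ P.CS + 1)
    (ha : ∀ i, 0 ≤ va i) (ht : ∀ t, 0 ≤ vt t) (hw : 1 ≤ eval va vt (w P)) :
    eval va vt (Rem.openTriangleEsh P ρ m k) ≤ eval va vt (Rem.openTriangleEplus P ρ m k) := by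
  have hWk : 1 ≤ eval va vt (w P) ^ k := one_le_pow₀ hw
  have hS : 0 ≤ eval va vt (openTriangleSmax P m) := eval_nonneg ha ht _
  have hA := eval_openTriangleEsh_mul_wpow P ρ (va := va) (vt := vt) hd hk hkC (ha .z)
  have hB := eval_openTriangleEplus_mul_wpow P ρ (va := va) (vt := vt) (m := m) hkC
  have key : eval va vt (Rem.openTriangleEsh P ρ m k) * eval va vt (w P) ^ k ≤ eval va vt (Rem.openTriangleEplus P ρ m k) * eval va vt (w P) ^ k := by
    rw [hA, hB]; nlinarith
  exact le_of_mul_le_mul_right key (lt_of_lt_of_le one_pos hWk)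

/-- DIRECTION, D27+D26 square: `⟦Rem.openSquareEDsh m k⟧ ≤ ⟦Rem.openSquareEDplus m k⟧` under the same hypotheses. [cite: FitznerVanDerHofstad2017, notebook Percolation.nb cell 12 (transcript l.419–429)] -/
theorem eval_openSquareEDsh_le_EDplus (hd : 0 < P.d) {m k : ℕ} (hk : k ≤ m) (hkC : k ≤ P.CS + 1)
    (ha : ∀ i, 0 ≤ va i) (ht : ∀ t, 0 ≤ vt t) (hw : 1 ≤ eval va vt (w P)) :
    eval va vt (Rem.openSquareEDsh P ρ m k) ≤ eval va vt (Rem.openSquareEDplus P ρ m k) := by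
  have hWk : 1 ≤ eval va vt (w P) ^ k := one_le_pow₀ hw
  have hS : 0 ≤ eval va vt (openSquareSmax P m) := eval_nonneg ha ht _
  have hA := eval_openSquareEDsh_mul_wpow P ρ (va := va) (vt := vt) hd hk hkC (ha .z)
  have hB := eval_openSquareEDplus_mul_wpow P ρ (va := va) (vt := vt) (m := m) hkC
  have key : eval va vt (Rem.openSquareEDsh P ρ m k) * eval va vt (w P) ^ k ≤ eval va vt (Rem.openSquareEDplus P ρ m k) * eval va vt (w P) ^ k := by
    rw [hA, hB]; nlinarith
  exact le_of_mul_le_mul_right key (lt_of_lt_of_le one_pos hWk)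

/-- DIRECTION, D12 square: `⟦Rem.openSquareEsh m k⟧ ≤ ⟦Rem.openSquareEplus m k⟧` under the same hypotheses. [cite: FitznerVanDerHofstad2017, notebook Percolation.nb cell 12 (transcript l.419–429)] -/
theorem eval_openSquareEsh_le_Eplus (hd : 0 < P.d) {m k : ℕ} (hk : k ≤ m) (hkC : k ≤ P.CS + 1)
    (ha : ∀ i, 0 ≤ va i) (ht : ∀ t, 0 ≤ vt t) (hw : 1 ≤ eval va vt (w P)) :
    eval va vt (Rem.openSquareEsh P ρ m k) ≤ eval va vt (Rem.openSquareEplus P ρ m k) := by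
  have hWk : 1 ≤ eval va vt (w P) ^ k := one_le_pow₀ hw
  have hS : 0 ≤ eval va vt (openSquareSmax P m) := eval_nonneg ha ht _
  have hA := eval_openSquareEsh_mul_wpow P ρ (va := va) (vt := vt) hd hk hkC (ha .z)
  have hB := eval_openSquareEplus_mul_wpow P ρ (va := va) (vt := vt) (m := m) hkC
  have key : eval va vt (Rem.openSquareEsh P ρ m k) * eval va vt (w P) ^ k ≤ eval va vt (Rem.openSquareEplus P ρ m k) * eval va vt (w P) ^ k := by
    rw [hA, hB]; nlinarith
  exact le_of_mul_le_mul_right key (lt_of_lt_of_le one_pos hWk)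

/-- the composite cells inherit the direction: `⟦Rem.openTriangleDsh m k⟧ ≤ ⟦Rem.openTriangleDplus m k⟧` (`Min[K, ·]` is monotone). [cite: FitznerVanDerHofstad2017, notebook Percolation.nb cell 12 (transcript l.419–429)] -/
theorem eval_openTriangleDsh_le_Dplus (hd : 0 < P.d) {m k : ℕ} (hk : k ≤ m) (hkC : k ≤ P.CS + 1)
    (ha : ∀ i, 0 ≤ va i) (ht : ∀ t, 0 ≤ vt t) (hw : 1 ≤ eval va vt (w P)) :
    eval va vt (Rem.openTriangleDsh P ρ m k) ≤ eval va vt (Rem.openTriangleDplus P ρ m k) := by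
  simp only [Rem.openTriangleDsh, Rem.openTriangleDplus, eval_min]
  exact min_le_min le_rfl (eval_openTriangleEDsh_le_EDplus P ρ hd hk hkC ha ht hw)

/-- `⟦Rem.openSquareDsh m k⟧ ≤ ⟦Rem.openSquareDplus m k⟧`. [cite: FitznerVanDerHofstad2017, notebook Percolation.nb cell 12 (transcript l.419–429)] -/
theorem eval_openSquareDsh_le_Dplus (hd : 0 < P.d) {m k : ℕ} (hk : k ≤ m) (hkC : k ≤ P.CS + 1)
    (ha : ∀ i, 0 ≤ va i) (ht : ∀ t, 0 ≤ vt t) (hw : 1 ≤ eval va vt (w P)) :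
    eval va vt (Rem.openSquareDsh P ρ m k) ≤ eval va vt (Rem.openSquareDplus P ρ m k) := by
  simp only [Rem.openSquareDsh, Rem.openSquareDplus, eval_min]
  exact min_le_min le_rfl (eval_openSquareEDsh_le_EDplus P ρ hd hk hkC ha ht hw)

/-! ### Plain cells (record reads): the same statements through the `rfl` reproductions -/

/-- plain D27 triangle: `⟦openTriangleEDsh m k⟧ · (2dz)^k = ⟦openTriangleEDplus m 0⟧`. [cite: FitznerVanDerHofstad2017, notebook Percolation.nb cell 12 (transcript l.419–429)] -/
theorem eval_openTriangleEDsh_mul_wpow_plain (hd : 0 < P.d) {m k : ℕ} (hk : k ≤ m) (hkC : k ≤ P.CS + 1) (hz : 0 ≤ va .z) :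
    eval va vt (Stage1Cells.openTriangleEDsh P m k) * eval va vt (w P) ^ k = eval va vt (Stage1Cells.openTriangleEDplus P m 0) := by
  simpa only [openTriangleEDsh_print, openTriangleEDplus_print] using
    eval_openTriangleEDsh_mul_wpow P (printSlots P) (va := va) (vt := vt) hd hk hkC hz

/-- plain D27 triangle, direction: `⟦openTriangleDsh m k⟧ ≤ ⟦openTriangleDplus m k⟧`. [cite: FitznerVanDerHofstad2017, notebook Percolation.nb cell 12 (transcript l.419–429)] -/
theorem eval_openTriangleDsh_le_Dplus_plain (hd : 0 < P.d) {m k : ℕ} (hk : k ≤ m) (hkC : k ≤ P.CS + 1)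
    (ha : ∀ i, 0 ≤ va i) (ht : ∀ t, 0 ≤ vt t) (hw : 1 ≤ eval va vt (w P)) :
    eval va vt (Stage1Cells.openTriangleDsh P m k) ≤ eval va vt (Stage1Cells.openTriangleDplus P m k) := by
  simpa only [openTriangleDsh_print, openTriangleDplus_print] using
    eval_openTriangleDsh_le_Dplus P (printSlots P) (va := va) (vt := vt) hd hk hkC ha ht hw

end Semantics

end Rem

/-! ## §3 Kernel facts at the scratch point (dataHi, P40 = (10,18,40), ρ40, `CertD10.stateRev3`) — the live instance `openTriangle (3,1)` on the tree side
(RULING D49 (2) class: kernel values of typed cells over the landed record tables at the cell's scratch slots; not numbers of record; `ρ40` = eng g10/g14's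
`R6Twin.rho40` verbatim = Engine C R-6's instance = the typer g4 probe's). -/

namespace OpenShift

/-- the nbw-min slot numerals at `P40` (eng `R6Twin.nbwSlot40`, verbatim). [cite: FitznerVanDerHofstad2017, notebook Percolation.nb cells 11–12 (transcript l.389–429)] -/
def nbwSlot40 (i : Fin 10) : T :=
  C (CertD10.EvalO18K8.nbwNum (CertD10.EvalO18K8.readOf i)) /ₙ (2 * CertD10.P40.d) ^ ((CertD10.EvalO18K8.readOf i).order CertD10.P40.CS)

/-- the scratch slots `ρ40 i = min (printSlots P40 i) (nbwSlot40 i)` (eng `R6Twin.rho40`, verbatim). [cite: FitznerVanDerHofstad2017, notebook Percolation.nb cells 11–12 (transcript l.389–429)] -/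
def rho40 : Fin 10 → T := fun i => min (printSlots CertD10.P40 i) (nbwSlot40 i)

set_option maxHeartbeats 4000000 in
/-- `Rem.openTriangleEDsh CertD10.P40 ρ40 3 1` at `o` ∈ [0.024913729549299343849, 0.024913729549299343850] (kernel, outward 20 sig.). [cite: FitznerVanDerHofstad2017, notebook Percolation.nb cell 12 (transcript l.419–429)] -/
theorem sh_o_openTriangleEDsh_3_1 :
    (24913729549299343849 : ℚ) / 1000000000000000000000 ≤ CertD10.dataHi.evRm CertD10.P40 rho40 .o CertD10.stateRev3 (Rem.openTriangleEDsh CertD10.P40 rho40 3 1) ∧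
    CertD10.dataHi.evRm CertD10.P40 rho40 .o CertD10.stateRev3 (Rem.openTriangleEDsh CertD10.P40 rho40 3 1) ≤ (498274590985986877 : ℚ) / 20000000000000000000 := by
  constructor <;> decide +kernel

set_option maxHeartbeats 4000000 in
/-- `Rem.openTriangleEDplus CertD10.P40 ρ40 3 1` at `o` ∈ [0.026130364984731924258, 0.026130364984731924259] (kernel, outward 20 sig.). [cite: FitznerVanDerHofstad2017, notebook Percolation.nb cell 12 (transcript l.419–429)] -/
theorem sh_o_openTriangleEDplus_3_1 :
    (13065182492365962129 : ℚ) / 500000000000000000000 ≤ CertD10.dataHi.evRm CertD10.P40 rho40 .o CertD10.stateRev3 (Rem.openTriangleEDplus CertD10.P40 rho40 3 1) ∧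
    CertD10.dataHi.evRm CertD10.P40 rho40 .o CertD10.stateRev3 (Rem.openTriangleEDplus CertD10.P40 rho40 3 1) ≤ (26130364984731924259 : ℚ) / 1000000000000000000000 := by
  constructor <;> decide +kernel

set_option maxHeartbeats 4000000 in
/-- `Rem.openTriangleEDsh CertD10.P40 ρ40 3 1` at `i` ∈ [0.020021582072465595018, 0.020021582072465595019] (kernel, outward 20 sig.). [cite: FitznerVanDerHofstad2017, notebook Percolation.nb cell 12 (transcript l.419–429)] -/
theorem sh_i_openTriangleEDsh_3_1 :
    (10010791036232797509 : ℚ) / 500000000000000000000 ≤ CertD10.dataHi.evRm CertD10.P40 rho40 .i CertD10.stateRev3 (Rem.openTriangleEDsh CertD10.P40 rho40 3 1) ∧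
    CertD10.dataHi.evRm CertD10.P40 rho40 .i CertD10.stateRev3 (Rem.openTriangleEDsh CertD10.P40 rho40 3 1) ≤ (20021582072465595019 : ℚ) / 1000000000000000000000 := by
  constructor <;> decide +kernel

set_option maxHeartbeats 4000000 in
/-- `Rem.openTriangleEDplus CertD10.P40 ρ40 3 1` at `i` ∈ [0.020858536662060663318, 0.020858536662060663319] (kernel, outward 20 sig.). [cite: FitznerVanDerHofstad2017, notebook Percolation.nb cell 12 (transcript l.419–429)] -/
theorem sh_i_openTriangleEDplus_3_1 :
    (10429268331030331659 : ℚ) / 500000000000000000000 ≤ CertD10.dataHi.evRm CertD10.P40 rho40 .i CertD10.stateRev3 (Rem.openTriangleEDplus CertD10.P40 rho40 3 1) ∧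
    CertD10.dataHi.evRm CertD10.P40 rho40 .i CertD10.stateRev3 (Rem.openTriangleEDplus CertD10.P40 rho40 3 1) ≤ (20858536662060663319 : ℚ) / 1000000000000000000000 := by
  constructor <;> decide +kernel


set_option maxHeartbeats 4000000 in
/-- **(A) decided at the live instance**: `⟦EDsh 3 1⟧ · (2dz) = ⟦EDplus 3 0⟧` EXACTLY at `o` and at `i` (second path to `eval_openTriangleEDsh_mul_wpow`).
[cite: FitznerVanDerHofstad2017, notebook Percolation.nb cell 12 (transcript l.419–429)] -/
theorem sh_tie_3_1 :
    CertD10.dataHi.evRm CertD10.P40 rho40 .o CertD10.stateRev3 (Rem.openTriangleEDsh CertD10.P40 rho40 3 1)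
        * CertD10.dataHi.evRm CertD10.P40 rho40 .o CertD10.stateRev3 (w CertD10.P40)
      = CertD10.dataHi.evRm CertD10.P40 rho40 .o CertD10.stateRev3 (Rem.openTriangleEDplus CertD10.P40 rho40 3 0) ∧
    CertD10.dataHi.evRm CertD10.P40 rho40 .i CertD10.stateRev3 (Rem.openTriangleEDsh CertD10.P40 rho40 3 1)
        * CertD10.dataHi.evRm CertD10.P40 rho40 .i CertD10.stateRev3 (w CertD10.P40)
      = CertD10.dataHi.evRm CertD10.P40 rho40 .i CertD10.stateRev3 (Rem.openTriangleEDplus CertD10.P40 rho40 3 0) := by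
  constructor <;> decide +kernel

set_option maxHeartbeats 4000000 in
/-- **(B) decided at the live instance**: `⟦EDplus 3 1⟧ · (2dz) = ⟦EDplus 3 0⟧ + ⟦S_max 3⟧ · (2dz − 1)` EXACTLY at `o` and at `i`.
[cite: FitznerVanDerHofstad2017, notebook Percolation.nb cell 12 (transcript l.419–429)] -/
theorem landed_tie_3_1 :
    CertD10.dataHi.evRm CertD10.P40 rho40 .o CertD10.stateRev3 (Rem.openTriangleEDplus CertD10.P40 rho40 3 1)
        * CertD10.dataHi.evRm CertD10.P40 rho40 .o CertD10.stateRev3 (w CertD10.P40)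
      = CertD10.dataHi.evRm CertD10.P40 rho40 .o CertD10.stateRev3 (Rem.openTriangleEDplus CertD10.P40 rho40 3 0)
        + CertD10.dataHi.evRm CertD10.P40 rho40 .o CertD10.stateRev3 (openTriangleSmax CertD10.P40 3)
          * (CertD10.dataHi.evRm CertD10.P40 rho40 .o CertD10.stateRev3 (w CertD10.P40) - 1) ∧
    CertD10.dataHi.evRm CertD10.P40 rho40 .i CertD10.stateRev3 (Rem.openTriangleEDplus CertD10.P40 rho40 3 1)
        * CertD10.dataHi.evRm CertD10.P40 rho40 .i CertD10.stateRev3 (w CertD10.P40)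
      = CertD10.dataHi.evRm CertD10.P40 rho40 .i CertD10.stateRev3 (Rem.openTriangleEDplus CertD10.P40 rho40 3 0)
        + CertD10.dataHi.evRm CertD10.P40 rho40 .i CertD10.stateRev3 (openTriangleSmax CertD10.P40 3)
          * (CertD10.dataHi.evRm CertD10.P40 rho40 .i CertD10.stateRev3 (w CertD10.P40) - 1) := by
  constructor <;> decide +kernel

set_option maxHeartbeats 4000000 in
/-- **size of the defect at the live instance**: `1.0488 < ⟦EDplus 3 1⟧/⟦EDsh 3 1⟧ < 1.0489` at `o` and `1.0418 < · < 1.0419` at `i` (eng g14: +4.88 % / +4.18 %).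
[cite: FitznerVanDerHofstad2017, notebook Percolation.nb cell 12 (transcript l.419–429)] -/
theorem landed_over_shifted_3_1 :
    (10488 : ℚ) / 10000 * CertD10.dataHi.evRm CertD10.P40 rho40 .o CertD10.stateRev3 (Rem.openTriangleEDsh CertD10.P40 rho40 3 1)
        < CertD10.dataHi.evRm CertD10.P40 rho40 .o CertD10.stateRev3 (Rem.openTriangleEDplus CertD10.P40 rho40 3 1) ∧
    CertD10.dataHi.evRm CertD10.P40 rho40 .o CertD10.stateRev3 (Rem.openTriangleEDplus CertD10.P40 rho40 3 1)
        < (10489 : ℚ) / 10000 * CertD10.dataHi.evRm CertD10.P40 rho40 .o CertD10.stateRev3 (Rem.openTriangleEDsh CertD10.P40 rho40 3 1) ∧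
    (10418 : ℚ) / 10000 * CertD10.dataHi.evRm CertD10.P40 rho40 .i CertD10.stateRev3 (Rem.openTriangleEDsh CertD10.P40 rho40 3 1)
        < CertD10.dataHi.evRm CertD10.P40 rho40 .i CertD10.stateRev3 (Rem.openTriangleEDplus CertD10.P40 rho40 3 1) ∧
    CertD10.dataHi.evRm CertD10.P40 rho40 .i CertD10.stateRev3 (Rem.openTriangleEDplus CertD10.P40 rho40 3 1)
        < (10419 : ℚ) / 10000 * CertD10.dataHi.evRm CertD10.P40 rho40 .i CertD10.stateRev3 (Rem.openTriangleEDsh CertD10.P40 rho40 3 1) := by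
  refine ⟨?_, ?_, ?_, ?_⟩ <;> decide +kernel

set_option maxHeartbeats 4000000 in
/-- **branch**: after the shift the extraction branch is STILL the minimum at `(3,1)` — `⟦EDsh 3 1⟧ < ⟦K-branch 3 1⟧` at `o` and `i`, hence
`⟦Rem.openTriangleDsh 3 1⟧ = ⟦Rem.openTriangleEDsh 3 1⟧`. [cite: FitznerVanDerHofstad2017, notebook Percolation.nb cell 12 (transcript l.419–429)] -/
theorem sh_branch_3_1 :
    CertD10.dataHi.evRm CertD10.P40 rho40 .o CertD10.stateRev3 (Rem.openTriangleEDsh CertD10.P40 rho40 3 1)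
        < CertD10.dataHi.evRm CertD10.P40 rho40 .o CertD10.stateRev3 (openTriangleK CertD10.P40 3 1) ∧
    CertD10.dataHi.evRm CertD10.P40 rho40 .i CertD10.stateRev3 (Rem.openTriangleEDsh CertD10.P40 rho40 3 1)
        < CertD10.dataHi.evRm CertD10.P40 rho40 .i CertD10.stateRev3 (openTriangleK CertD10.P40 3 1) := by
  constructor <;> decide +kernel

/-- so the shifted COMPOSITE cell takes the value of its extraction branch at `(3,1)`, both points. [cite: FitznerVanDerHofstad2017, notebook Percolation.nb cell 12 (transcript l.419–429)] -/
theorem sh_Dsh_eq_EDsh_3_1 (s : Pt) :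
    CertD10.dataHi.evRm CertD10.P40 rho40 s CertD10.stateRev3 (Rem.openTriangleDsh CertD10.P40 rho40 3 1)
      = CertD10.dataHi.evRm CertD10.P40 rho40 s CertD10.stateRev3 (Rem.openTriangleEDsh CertD10.P40 rho40 3 1) := by
  rw [Rem.openTriangleDsh, DataQ.evRm_min]
  cases s
  · exact min_eq_right sh_branch_3_1.2.le
  · exact min_eq_right sh_branch_3_1.1.le

set_option maxHeartbeats 4000000 in
/-- `k = 0` instances decided (second path to the `…_zero` lemmas): the shifted and landed cells are EQUAL at `openTriangle (3,0)` and `openSquare (3,0)`, both points.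
[cite: FitznerVanDerHofstad2017, notebook Percolation.nb cell 12 (transcript l.419–429)] -/
theorem sh_zero_instances (s : Pt) :
    CertD10.dataHi.evRm CertD10.P40 rho40 s CertD10.stateRev3 (Rem.openTriangleEDsh CertD10.P40 rho40 3 0)
      = CertD10.dataHi.evRm CertD10.P40 rho40 s CertD10.stateRev3 (Rem.openTriangleEDplus CertD10.P40 rho40 3 0) ∧
    CertD10.dataHi.evRm CertD10.P40 rho40 s CertD10.stateRev3 (Rem.openSquareEDsh CertD10.P40 rho40 3 0)
      = CertD10.dataHi.evRm CertD10.P40 rho40 s CertD10.stateRev3 (Rem.openSquareEDplus CertD10.P40 rho40 3 0) := by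
  cases s <;> constructor <;> decide +kernel

end OpenShift

end Stage1Cells
end Literature.Probability.FitznerVanDerHofstad2017
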